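import Summits.FinalStateConjecture.FinalStateConjecture.Theorems.ClusterCompletenessAdiabaticMultiKerrILEDFarPointwise

/-!
# Crux `AdiabaticMultiKerrILED` (line `Sketch`) — pointwise bounds for the cut-off far-field current

Helper file for the crux `stmt-FinalStateConjecture-14310`
(`Summit.FinalStateConjecture.FinalStateConjecture.Theses.ClusterCompleteness.AdiabaticMultiKerrILED`),
far-field stub `stub_farTransport`: with the flat KSS pair `(X_g, ϖ)` of `stub_flatMorawetzBulk`
(`|g(s)|√s ≤ 1`, `|ϖ(s)|(√s + R) ≤ 8`, `‖d(ϖ∘s)‖(√s + R)² ≤ 32`) and a cut-off `0 ≤ ζ ≤ 1`,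
every component of `J = J^{ζX_g}_η[w] + ¼ L^{ζϖ}_η[w]` satisfies
`|J^μ| ≤ 5 ζ ∑p² + 12 ζ w²/(√s + R)² + |∂_μζ| w²/(√s + R)` (`abs_farCurrent_le`): every term carries
`ζ` or `dζ`, so `J` lives on the exterior and its zeroth-order part is Hardy-weighted. [folklore]
-/

noncomputable section

-- the doubled `FinalStateConjecture.FinalStateConjecture` path component trips dupNamespace
set_option linter.dupNamespace false

open scoped ContDiff Topology
open Filter Set Literature.Geometry.Lorentzian Literature.Geometry.Lorentzian.KerrSchild

namespace Summit.FinalStateConjecture.FinalStateConjecture.Cruxes.AdiabaticMultiKerrILED.Sketch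

/-! ### Pointwise bounds for the cut-off far current -/

section FarBounds

/-- **Components of the cut-off radial field**: `∑_α |ζ X_g^α| ≤ 3 ζ` when `|g(s)| √s ≤ 1` and
`0 ≤ ζ`. [folklore] -/
theorem sum_abs_cutoff_radial_le {g : ℝ → ℝ} (hgb : ∀ y : E4, |g (E4.spatialNorm y ^ 2)| * E4.spatialNorm y ≤ 1)
    {ζ : E4 → ℝ} {x : E4} (hζ0 : 0 ≤ ζ x) :
    ∑ α, |ζ x * (if α = 0 then (0 : ℝ) else g (E4.spatialNorm x ^ 2) * x α)| ≤ 3 * ζ x := by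
  have hcoord : ∀ α : Fin 4, α ≠ 0 → |x α| ≤ E4.spatialNorm x := by
    intro α hα
    have h0 := E4.spatialNorm_nonneg x
    have hsq := E4.spatialNorm_sq x
    rw [← Real.sqrt_sq_eq_abs, show E4.spatialNorm x = Real.sqrt (E4.spatialNorm x ^ 2) from
      (Real.sqrt_sq h0).symm, hsq]
    apply Real.sqrt_le_sqrt
    fin_cases α
    · exact absurd rfl hα
    all_goals simp; nlinarith [sq_nonneg (x 1), sq_nonneg (x 2), sq_nonneg (x 3)]
  have hXg : ∀ α : Fin 4, |(if α = 0 then (0 : ℝ) else g (E4.spatialNorm x ^ 2) * x α)| ≤ 1 := by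
    intro α
    by_cases hα : α = 0
    · simp [hα]
    · simp only [hα, if_false, abs_mul]
      calc |g (E4.spatialNorm x ^ 2)| * |x α| ≤ |g (E4.spatialNorm x ^ 2)| * E4.spatialNorm x :=
            mul_le_mul_of_nonneg_left (hcoord α hα) (abs_nonneg _)
        _ ≤ 1 := hgb x
  have h0term : |ζ x * (if (0 : Fin 4) = 0 then (0 : ℝ) else g (E4.spatialNorm x ^ 2) * x 0)| = 0 := by simp
  calc ∑ α, |ζ x * (if α = 0 then (0 : ℝ) else g (E4.spatialNorm x ^ 2) * x α)|
      = ∑ α, ζ x * |(if α = 0 then (0 : ℝ) else g (E4.spatialNorm x ^ 2) * x α)| := by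
        refine Finset.sum_congr rfl fun α _ ↦ ?_
        rw [abs_mul, abs_of_nonneg hζ0]
    _ ≤ ζ x * |(if (1 : Fin 4) = 0 then (0 : ℝ) else g (E4.spatialNorm x ^ 2) * x 1)| +
        ζ x * |(if (2 : Fin 4) = 0 then (0 : ℝ) else g (E4.spatialNorm x ^ 2) * x 2)| +
        ζ x * |(if (3 : Fin 4) = 0 then (0 : ℝ) else g (E4.spatialNorm x ^ 2) * x 3)| := by
        rw [Fin.sum_univ_four]
        simp
    _ ≤ ζ x * 1 + ζ x * 1 + ζ x * 1 := by
        gcongr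
        · exact hXg 1
        · exact hXg 2
        · exact hXg 3
    _ = 3 * ζ x := by ring

/-- **Pointwise bound for the cut-off far current.** With `|g(s)|√s ≤ 1`, `|ϖ(s)| (√s + R) ≤ 8`,
`‖d(ϖ∘s)‖ (√s + R)² ≤ 32`, `0 ≤ ζ ≤ 1`: every component of
`J = J^{ζX_g}_η[w] + ¼ L^{ζϖ}_η[w]` satisfies
`|J^μ| ≤ 5 ζ ∑p² + 12 ζ w²/(√s + R)² + |∂_μζ| w²/(√s + R)`. [folklore] -/
theorem abs_farCurrent_le {g ϖ : ℝ → ℝ} {R : ℝ} (hR : 0 < R)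
    (hgb : ∀ y : E4, |g (E4.spatialNorm y ^ 2)| * E4.spatialNorm y ≤ 1)
    (hϖb : ∀ y : E4, |ϖ (E4.spatialNorm y ^ 2)| * (E4.spatialNorm y + R) ≤ 8)
    (hdϖb : ∀ y : E4, ‖fderiv ℝ (fun z : E4 ↦ ϖ (E4.spatialNorm z ^ 2)) y‖ * (E4.spatialNorm y + R) ^ 2 ≤ 32)
    {ζ : E4 → ℝ} (hζ01 : ∀ y, 0 ≤ ζ y ∧ ζ y ≤ 1) {x : E4}
    (hζd : DifferentiableAt ℝ ζ x) (hϖd : DifferentiableAt ℝ (fun z : E4 ↦ ϖ (E4.spatialNorm z ^ 2)) x)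
    (w : E4 → ℝ) (μ : Fin 4) :
    |multiplierCurrent (fun _ ↦ Kerr.etaComp)
        (fun z α ↦ ζ z * (if α = 0 then (0 : ℝ) else g (E4.spatialNorm z ^ 2) * z α)) w x μ +
      4⁻¹ * lagrangianCurrent (fun _ ↦ Kerr.etaComp) (fun z ↦ ζ z * ϖ (E4.spatialNorm z ^ 2)) w x μ| ≤
      5 * ζ x * (∑ κ, (fderiv ℝ w x (E4.basisVector κ)) ^ 2) +
        12 * ζ x * (w x ^ 2 / (E4.spatialNorm x + R) ^ 2) +
        |fderiv ℝ ζ x (E4.basisVector μ)| * (w x ^ 2 / (E4.spatialNorm x + R)) := by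
  set P := ∑ κ, (fderiv ℝ w x (E4.basisVector κ)) ^ 2 with hP
  set r := E4.spatialNorm x with hr
  have hr0 : 0 ≤ r := E4.spatialNorm_nonneg x
  have hrR : 0 < r + R := by linarith
  have hζ0 := (hζ01 x).1
  have hζ1 := (hζ01 x).2
  have hPnn : 0 ≤ P := Finset.sum_nonneg fun _ _ ↦ sq_nonneg _
  -- the multiplier current
  have hJ := abs_multiplierCurrent_eta_le
    (fun z α ↦ ζ z * (if α = 0 then (0 : ℝ) else g (E4.spatialNorm z ^ 2) * z α)) w x μ
  have hX := sum_abs_cutoff_radial_le hgb (ζ := ζ) hζ0 (x := x)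
  have hJ' : |multiplierCurrent (fun _ ↦ Kerr.etaComp)
      (fun z α ↦ ζ z * (if α = 0 then (0 : ℝ) else g (E4.spatialNorm z ^ 2) * z α)) w x μ| ≤
      9 / 2 * ζ x * P := by
    refine hJ.trans ?_
    calc 3 / 2 * (∑ α, |ζ x * (if α = 0 then (0 : ℝ) else g (E4.spatialNorm x ^ 2) * x α)|) * P
        ≤ 3 / 2 * (3 * ζ x) * P := by gcongr
      _ = 9 / 2 * ζ x * P := by ring
  -- the Lagrangian current: `L^μ = ϖ̃ w (ηp)^μ − ½ w² (η dϖ̃)^μ`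
  obtain ⟨p, hp⟩ : ∃ p : Fin 4 → ℝ, ∀ κ, fderiv ℝ w x (E4.basisVector κ) = p κ := ⟨_, fun _ ↦ rfl⟩
  have hpμ : p μ ^ 2 ≤ P := by
    rw [hP]; simp only [hp]
    exact Finset.single_le_sum (f := fun κ ↦ p κ ^ 2) (fun _ _ ↦ sq_nonneg _) (Finset.mem_univ μ)
  -- derivative of `ϖ̃ = ζ ϖs`
  have hprod : fderiv ℝ (fun z ↦ ζ z * ϖ (E4.spatialNorm z ^ 2)) x =
      ζ x • fderiv ℝ (fun z : E4 ↦ ϖ (E4.spatialNorm z ^ 2)) x + ϖ (E4.spatialNorm x ^ 2) • fderiv ℝ ζ x :=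
    (hζd.hasFDerivAt.mul hϖd.hasFDerivAt).fderiv
  have hϖabs : |ϖ (E4.spatialNorm x ^ 2)| ≤ 8 / (r + R) := by
    rw [le_div_iff₀ hrR]; exact hϖb x
  have hdϖabs : |fderiv ℝ (fun z : E4 ↦ ϖ (E4.spatialNorm z ^ 2)) x (E4.basisVector μ)| ≤ 32 / (r + R) ^ 2 := by
    rw [le_div_iff₀ (by positivity)]
    calc |fderiv ℝ (fun z : E4 ↦ ϖ (E4.spatialNorm z ^ 2)) x (E4.basisVector μ)| * (r + R) ^ 2
        ≤ ‖fderiv ℝ (fun z : E4 ↦ ϖ (E4.spatialNorm z ^ 2)) x‖ * (r + R) ^ 2 :=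
          mul_le_mul_of_nonneg_right (abs_fderiv_apply_basisVector_le _ x μ) (by positivity)
      _ ≤ 32 := hdϖb x
  have hdϖt : |fderiv ℝ (fun z ↦ ζ z * ϖ (E4.spatialNorm z ^ 2)) x (E4.basisVector μ)| ≤
      ζ x * (32 / (r + R) ^ 2) + (8 / (r + R)) * |fderiv ℝ ζ x (E4.basisVector μ)| := by
    rw [hprod]
    simp only [add_apply, smul_apply, smul_eq_mul]
    calc |ζ x * fderiv ℝ (fun z : E4 ↦ ϖ (E4.spatialNorm z ^ 2)) x (E4.basisVector μ) +
          ϖ (E4.spatialNorm x ^ 2) * fderiv ℝ ζ x (E4.basisVector μ)|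
        ≤ |ζ x * fderiv ℝ (fun z : E4 ↦ ϖ (E4.spatialNorm z ^ 2)) x (E4.basisVector μ)| +
          |ϖ (E4.spatialNorm x ^ 2) * fderiv ℝ ζ x (E4.basisVector μ)| := abs_add_le _ _
      _ = ζ x * |fderiv ℝ (fun z : E4 ↦ ϖ (E4.spatialNorm z ^ 2)) x (E4.basisVector μ)| +
          |ϖ (E4.spatialNorm x ^ 2)| * |fderiv ℝ ζ x (E4.basisVector μ)| := by
          rw [abs_mul, abs_of_nonneg hζ0, abs_mul]
      _ ≤ ζ x * (32 / (r + R) ^ 2) + (8 / (r + R)) * |fderiv ℝ ζ x (E4.basisVector μ)| := by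
          gcongr
  -- the Lagrangian current written out
  have hL : lagrangianCurrent (fun _ ↦ Kerr.etaComp) (fun z ↦ ζ z * ϖ (E4.spatialNorm z ^ 2)) w x μ =
      (ζ x * ϖ (E4.spatialNorm x ^ 2)) * w x * (∑ ν, Kerr.etaComp μ ν * p ν) -
        2⁻¹ * w x ^ 2 * ∑ ν, Kerr.etaComp μ ν *
          fderiv ℝ (fun z ↦ ζ z * ϖ (E4.spatialNorm z ^ 2)) x (E4.basisVector ν) := by
    simp only [lagrangianCurrent, hp]
  have hA : |∑ ν, Kerr.etaComp μ ν * p ν| = |p μ| := abs_sum_etaComp_mul p μ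
  have hB : |∑ ν, Kerr.etaComp μ ν * fderiv ℝ (fun z ↦ ζ z * ϖ (E4.spatialNorm z ^ 2)) x (E4.basisVector ν)| =
      |fderiv ℝ (fun z ↦ ζ z * ϖ (E4.spatialNorm z ^ 2)) x (E4.basisVector μ)| :=
    abs_sum_etaComp_mul (fun ν ↦ fderiv ℝ (fun z ↦ ζ z * ϖ (E4.spatialNorm z ^ 2)) x (E4.basisVector ν)) μ
  -- first Lagrangian term: `|ζ ϖs w p_μ| ≤ ½ ζ (p_μ² + ϖs² w²) ≤ ½ ζ P + 32 ζ w²/(r+R)²`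
  have hL1 : |(ζ x * ϖ (E4.spatialNorm x ^ 2)) * w x * (∑ ν, Kerr.etaComp μ ν * p ν)| ≤
      2⁻¹ * ζ x * P + 32 * ζ x * (w x ^ 2 / (r + R) ^ 2) := by
    rw [abs_mul, hA, abs_mul, abs_mul, abs_of_nonneg hζ0]
    have h1 : |ϖ (E4.spatialNorm x ^ 2)| * |w x| * |p μ| ≤ 2⁻¹ * (p μ ^ 2 + ϖ (E4.spatialNorm x ^ 2) ^ 2 * w x ^ 2) := by
      have := two_mul_le_add_sq (ϖ (E4.spatialNorm x ^ 2) * w x) (p μ)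
      rw [← abs_mul]
      have h' : |ϖ (E4.spatialNorm x ^ 2) * w x| * |p μ| ≤ ((ϖ (E4.spatialNorm x ^ 2) * w x) ^ 2 + p μ ^ 2) / 2 := by
        rw [← abs_mul, abs_le]; constructor <;>
          nlinarith [sq_nonneg (ϖ (E4.spatialNorm x ^ 2) * w x + p μ), sq_nonneg (ϖ (E4.spatialNorm x ^ 2) * w x - p μ)]
      nlinarith [h']
    have h2 : ϖ (E4.spatialNorm x ^ 2) ^ 2 ≤ (8 / (r + R)) ^ 2 := by
      rw [← sq_abs]; exact pow_le_pow_left₀ (abs_nonneg _) hϖabs 2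
    have h3 : ϖ (E4.spatialNorm x ^ 2) ^ 2 * w x ^ 2 ≤ 64 * (w x ^ 2 / (r + R) ^ 2) := by
      have : (8 / (r + R)) ^ 2 = 64 / (r + R) ^ 2 := by rw [div_pow]; norm_num
      rw [this] at h2
      have hw := sq_nonneg (w x)
      calc ϖ (E4.spatialNorm x ^ 2) ^ 2 * w x ^ 2 ≤ 64 / (r + R) ^ 2 * w x ^ 2 :=
            mul_le_mul_of_nonneg_right h2 hw
        _ = 64 * (w x ^ 2 / (r + R) ^ 2) := by ring
    calc ζ x * |ϖ (E4.spatialNorm x ^ 2)| * |w x| * |p μ|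
        = ζ x * (|ϖ (E4.spatialNorm x ^ 2)| * |w x| * |p μ|) := by ring
      _ ≤ ζ x * (2⁻¹ * (p μ ^ 2 + ϖ (E4.spatialNorm x ^ 2) ^ 2 * w x ^ 2)) :=
          mul_le_mul_of_nonneg_left h1 hζ0
      _ ≤ ζ x * (2⁻¹ * (P + 64 * (w x ^ 2 / (r + R) ^ 2))) := by gcongr
      _ = 2⁻¹ * ζ x * P + 32 * ζ x * (w x ^ 2 / (r + R) ^ 2) := by ring
  -- second Lagrangian term
  have hL2 : |2⁻¹ * w x ^ 2 * ∑ ν, Kerr.etaComp μ ν *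
      fderiv ℝ (fun z ↦ ζ z * ϖ (E4.spatialNorm z ^ 2)) x (E4.basisVector ν)| ≤
      2⁻¹ * w x ^ 2 * (ζ x * (32 / (r + R) ^ 2) + (8 / (r + R)) * |fderiv ℝ ζ x (E4.basisVector μ)|) := by
    rw [abs_mul, abs_mul, hB, abs_of_pos (by norm_num : (0 : ℝ) < 2⁻¹), abs_of_nonneg (sq_nonneg _)]
    exact mul_le_mul_of_nonneg_left hdϖt (by positivity)
  have hLabs : |lagrangianCurrent (fun _ ↦ Kerr.etaComp) (fun z ↦ ζ z * ϖ (E4.spatialNorm z ^ 2)) w x μ| ≤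
      2⁻¹ * ζ x * P + 48 * ζ x * (w x ^ 2 / (r + R) ^ 2) +
        4 * |fderiv ℝ ζ x (E4.basisVector μ)| * (w x ^ 2 / (r + R)) := by
    rw [hL]
    refine (abs_sub _ _).trans ?_
    have hsum := add_le_add hL1 hL2
    refine hsum.trans (le_of_eq ?_)
    field_simp
    ring
  -- combine
  calc |multiplierCurrent (fun _ ↦ Kerr.etaComp)
        (fun z α ↦ ζ z * (if α = 0 then (0 : ℝ) else g (E4.spatialNorm z ^ 2) * z α)) w x μ +
        4⁻¹ * lagrangianCurrent (fun _ ↦ Kerr.etaComp) (fun z ↦ ζ z * ϖ (E4.spatialNorm z ^ 2)) w x μ|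
      ≤ |multiplierCurrent (fun _ ↦ Kerr.etaComp)
          (fun z α ↦ ζ z * (if α = 0 then (0 : ℝ) else g (E4.spatialNorm z ^ 2) * z α)) w x μ| +
        |4⁻¹ * lagrangianCurrent (fun _ ↦ Kerr.etaComp) (fun z ↦ ζ z * ϖ (E4.spatialNorm z ^ 2)) w x μ| :=
        abs_add_le _ _
    _ ≤ 9 / 2 * ζ x * P + 4⁻¹ * (2⁻¹ * ζ x * P + 48 * ζ x * (w x ^ 2 / (r + R) ^ 2) +
        4 * |fderiv ℝ ζ x (E4.basisVector μ)| * (w x ^ 2 / (r + R))) := by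
        rw [abs_mul, abs_of_pos (by norm_num : (0 : ℝ) < 4⁻¹)]
        gcongr
    _ ≤ 5 * ζ x * P + 12 * ζ x * (w x ^ 2 / (r + R) ^ 2) +
        |fderiv ℝ ζ x (E4.basisVector μ)| * (w x ^ 2 / (r + R)) := by
        have : 0 ≤ ζ x * P := mul_nonneg hζ0 hPnn
        nlinarith [this]

end FarBounds

end Summit.FinalStateConjecture.FinalStateConjecture.Cruxes.AdiabaticMultiKerrILED.Sketch

end
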